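import Summits.Ventures.QEC.Thresholds.ToricCodeThresholdKernelSymm
import Literature.InformationTheory.QuantumCodes.ToricCodeInhomogeneous
import Literature.InformationTheory.QuantumCodes.ToricCodeMatching
import HarnessLib

/-!
# Certified toric-code thresholds under INHOMOGENEOUS independent noise (link-dependent rates `p_ℓ`):
# `sup_ℓ p_ℓ < p₀(μ')` suffices; kernel decimal `p_ℓ ≤ .0355` — UNCONDITIONAL

Venture QEC, `Summits/Ventures/QEC/Thresholds/` (LADDER-QEC rung Q5, PARTITION row 09 "noise models"; qec-type-09 gen 4,
item 09.ANISO). The Literature file `ToricCodeInhomogeneous.lean` PROVES that Dennis–Kitaev–Landahl–Preskill's counting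
bound survives replacing i.i.d. phase flips of rate `p` by INDEPENDENT flips with arbitrary link-dependent rates
`p_ℓ ≤ ρ` (`ToricCode.failureProbInhom`, via the exponential-Markov half-density bound of `InhomogeneousDensityBound.lean`).
Consequences (all UNCONDITIONAL, tier CERTIFIED (kernel), axioms standard, 0 facts, 0 `native_decide`):

| theorem | statement (certified LOWER bounds on the threshold region `{sup_ℓ p_ℓ < ·}`) |
|---|---|
| `toric_inhom_belowThreshold_of_connectiveConstant_le` | symbolic: `μ(ℤ²) ≤ μ'`, `1 ≤ μ'`, every min-weight decoder family, rates `0 ≤ p_{L,ℓ} ≤ ρ < p₀(μ')` ⇒ `Prob_fail → 0` |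
| `toric_inhom_belowThreshold_kernel` | the kernel bound `μ(ℤ²) ≤ 2.7014` (qec-type-03, symmetry-reduced memory-14): `ρ < p₀(2.7014)` suffices |
| `toric_inhom_belowThreshold_0355` | **decimal: rates `0 ≤ p_{L,ℓ} ≤ .0355` ⇒ `Prob_fail → 0`**, every min-weight decoder family |
| `toric_inhom_mwpm_belowThreshold_0355` | the same for every MWPM decoder family (`ToricCodeMatching.lean`) |
| `toric_inhom_failureProb_le_three` | finite size at DKLP's elementary count (`ν = 3`): `Prob_fail ≤ (8/9) L² (6s)^L/(1-6s)`, `s = √(ρ(1-ρ))` |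

## References
* [DennisEtAl2002] E. Dennis, A. Kitaev, A. Landahl, J. Preskill, *Topological quantum memory*, J. Math. Phys. 43
  (2002) 4452–4505, arXiv:quant-ph/0110143, §4.1, §5.3 eqs. (saw_d), (threshold_2d), (fail_2d), (p_c_2d).
-/

noncomputable section

namespace Summit.Ventures.QEC.Thresholds

open Filter Topology Finset
open Literature.InformationTheory.QuantumCodes
open Literature.InformationTheory.QuantumCodes.ToricCode
open Literature.Probability.RandomPlanarGeometry

/-- **Inhomogeneous-noise toric threshold, symbolic form**: if `μ(ℤ²) ≤ μ'` (`1 ≤ μ'`), then for every minimum-weight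
decoder family and every family of link-dependent rates `0 ≤ p_{L,ℓ} ≤ ρ` with `ρ < p₀(μ')`, the failure probability of
the `(L+1) × (L+1)` toric codes tends to `0` — UNCONDITIONAL. [cite: DennisEtAl2002, §5.3 eq. (threshold_2d)] -/
theorem toric_inhom_belowThreshold_of_connectiveConstant_le {μ' : ℝ} (hμ'1 : 1 ≤ μ')
    (hμ : SAW.Zd.connectiveConstant 2 ≤ μ') {D : (L : ℕ) → ZDecoder (L + 1)}
    (hD : ∀ L, (D L).IsMinWeight (syn (L + 1)) (cycles (L + 1)) hammingNorm)
    {r : (L : ℕ) → Edge (L + 1) → ℝ} {ρ : ℝ} (hr0 : ∀ L ℓ, 0 ≤ r L ℓ) (hrρ : ∀ L ℓ, r L ℓ ≤ ρ)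
    (hρt : ρ < thresholdValue μ') :
    Tendsto (fun L => failureProbInhom (L + 1) (D L) (r L)) atTop (𝓝 0) := by
  have hρ0 : 0 ≤ ρ := (hr0 0 ((0 : Vertex 1), 0)).trans (hrρ 0 _)
  have hρhalf : ρ ≤ 1 / 2 := hρt.le.trans (thresholdValue_le_half μ')
  have hlt : ρ * (1 - ρ) < thresholdValue μ' * (1 - thresholdValue μ') :=
    mul_one_sub_lt_mul_one_sub hρt (by linarith [thresholdValue_le_half μ'])
  have hμ'0 : 0 < μ' := lt_of_lt_of_le one_pos hμ'1
  have h4 : 4 * μ' ^ 2 * (ρ * (1 - ρ)) < 1 := by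
    calc 4 * μ' ^ 2 * (ρ * (1 - ρ)) < 4 * μ' ^ 2 * (thresholdValue μ' * (1 - thresholdValue μ')) := by
          gcongr
      _ = 1 := four_mul_sq_mul_thresholdValue hμ'1
  -- room to increase the base: choose `ν > μ'` with `4ν² ρ(1-ρ) < 1`
  have hρρ : 0 ≤ ρ * (1 - ρ) := mul_nonneg hρ0 (by linarith)
  obtain ⟨ν, hμν, h4ν⟩ : ∃ ν : ℝ, μ' < ν ∧ 4 * ν ^ 2 * (ρ * (1 - ρ)) < 1 := by
    rcases hρρ.eq_or_lt with hz | hpos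
    · exact ⟨μ' + 1, by linarith, by rw [← hz]; norm_num⟩
    · set x := ρ * (1 - ρ) with hx
      have hμx : μ' ^ 2 < 1 / (4 * x) := by
        rw [lt_div_iff₀ (by positivity)]; nlinarith
      set ν := Real.sqrt ((μ' ^ 2 + 1 / (4 * x)) / 2) with hν
      have hνsq : ν ^ 2 = (μ' ^ 2 + 1 / (4 * x)) / 2 := by
        rw [hν, Real.sq_sqrt (by positivity)]
      refine ⟨ν, ?_, ?_⟩
      · have : μ' ^ 2 < ν ^ 2 := by rw [hνsq]; linarith
        exact lt_of_pow_lt_pow_left₀ 2 (Real.sqrt_nonneg _) this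
      · have : ν ^ 2 < 1 / (4 * x) := by rw [hνsq]; linarith
        have hx4 : 0 < 4 * x := by positivity
        rw [lt_div_iff₀ hx4] at this
        linarith
  obtain ⟨C, hC⟩ := exists_sawCountBound_of_connectiveConstant_lt (lt_of_le_of_lt hμ hμν)
  exact toricThreshold_inhom (hμ'0.trans hμν) hC hD hr0 hrρ hρhalf h4ν

/-- **Inhomogeneous-noise toric threshold from the kernel bound `μ(ℤ²) ≤ 2.7014`**: rates `p_{L,ℓ} ≤ ρ < p₀(2.7014)`
suffice, for every minimum-weight decoder family — UNCONDITIONAL, tier CERTIFIED (kernel).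
[cite: DennisEtAl2002, §5.3 eq. (p_c_2d)] -/
theorem toric_inhom_belowThreshold_kernel {D : (L : ℕ) → ZDecoder (L + 1)}
    (hD : ∀ L, (D L).IsMinWeight (syn (L + 1)) (cycles (L + 1)) hammingNorm)
    {r : (L : ℕ) → Edge (L + 1) → ℝ} {ρ : ℝ} (hr0 : ∀ L ℓ, 0 ≤ r L ℓ) (hrρ : ∀ L ℓ, r L ℓ ≤ ρ)
    (hρt : ρ < thresholdValue 2.7014) :
    Tendsto (fun L => failureProbInhom (L + 1) (D L) (r L)) atTop (𝓝 0) :=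
  toric_inhom_belowThreshold_of_connectiveConstant_le (by norm_num) SAW.Zd.connectiveConstant_two_le_27014 hD
    hr0 hrρ hρt

/-- **Decimal form: link-dependent rates `0 ≤ p_{L,ℓ} ≤ .0355` ⇒ `Prob_fail → 0`** for every minimum-weight decoder
family — UNCONDITIONAL, kernel (a certified LOWER bound on the inhomogeneous threshold region).
[cite: DennisEtAl2002, §5.3 eq. (p_c_2d)] -/
theorem toric_inhom_belowThreshold_0355 {D : (L : ℕ) → ZDecoder (L + 1)}
    (hD : ∀ L, (D L).IsMinWeight (syn (L + 1)) (cycles (L + 1)) hammingNorm)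
    {r : (L : ℕ) → Edge (L + 1) → ℝ} (hr0 : ∀ L ℓ, 0 ≤ r L ℓ) (hr : ∀ L ℓ, r L ℓ ≤ 0.0355) :
    Tendsto (fun L => failureProbInhom (L + 1) (D L) (r L)) atTop (𝓝 0) :=
  toric_inhom_belowThreshold_kernel hD hr0 hr thresholdValue_27014_bounds.1

/-- **The same for every MWPM decoder family** (any admissible link metric, tie-break, geodesics;
`ToricCodeMatching.isMinWeight_of_isMatchingDecoder_star`): rates `≤ .0355` ⇒ `Prob_fail → 0` — UNCONDITIONAL, kernel.
[cite: DennisEtAl2002, §4.4 p. 18 and §5.3 eq. (p_c_2d)] -/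
theorem toric_inhom_mwpm_belowThreshold_0355 (m : (L : ℕ) → EdgeMetric (starEnds (L + 1)))
    {D : (L : ℕ) → ZDecoder (L + 1)} (hD : ∀ L, IsMatchingDecoder (m L) (D L))
    {r : (L : ℕ) → Edge (L + 1) → ℝ} (hr0 : ∀ L ℓ, 0 ≤ r L ℓ) (hr : ∀ L ℓ, r L ℓ ≤ 0.0355) :
    Tendsto (fun L => failureProbInhom (L + 1) (D L) (r L)) atTop (𝓝 0) :=
  toric_inhom_belowThreshold_0355 (fun L => isMinWeight_of_isMatchingDecoder_star (hD L)) hr0 hr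

/-- **Finite-size inhomogeneous bound at DKLP's elementary count** (`cₙ ≤ (4/3)·3ⁿ`): for `L ≥ 3`, a minimum-weight
decoder, rates `0 ≤ p_ℓ ≤ ρ ≤ 1/2` and `s := √(ρ(1-ρ))` with `6s < 1`, `Prob_fail ≤ 2L²·(4/3)·(6s)^L/(3(1-6s))`.
UNCONDITIONAL, kernel. [cite: DennisEtAl2002, §5.3 eqs. (saw_d), (fail_2d)] -/
theorem toric_inhom_failureProb_le_three (L : ℕ) [NeZero L] (hL : 3 ≤ L) {D : ZDecoder L}
    (hD : D.IsMinWeight (syn L) (cycles L) hammingNorm) {r : Edge L → ℝ} {ρ : ℝ} (hr0 : ∀ ℓ, 0 ≤ r ℓ)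
    (hrρ : ∀ ℓ, r ℓ ≤ ρ) (hρ : ρ ≤ 1 / 2) (hs : 6 * Real.sqrt (ρ * (1 - ρ)) < 1) :
    failureProbInhom L D r ≤
      2 * (L : ℝ) ^ 2 * (4 / 3) * (2 * 3 * Real.sqrt (ρ * (1 - ρ))) ^ L / (3 * (1 - 2 * 3 * Real.sqrt (ρ * (1 - ρ)))) :=
  failureProbInhom_le_of_sawCountBound (by norm_num) sawCountBound_three L hL D hD hr0 hrρ hρ (by linarith)

end Summit.Ventures.QEC.Thresholds

end
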